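import Mathlib

/-!
# T5SubgroupDescent — descent of a character along H → (H ⊔ N)/N (Tier-5 support, seat p3)

Kernel witness behind ONE line already on the record: route/T5-route-3.md v0.31 §F.2 (the
§G/N4.2 owner file), «The character ψ_T ⊗ 1 of H_𝔪 descends to the open subgroup E¹H_𝔪/E¹ of
the COMPACT abelian group E¹(𝔸)/E¹ (E¹ anisotropic) iff it is trivial on Γ_𝔪 := E¹ ∩ H_𝔪»,
together with its two supporting one-liners «ker(ψ_T|_Γ) has finite index in Γ» (ψ_T of finite
order) and «the open subgroup E¹H_𝔪/E¹».

This file proves the BARE group-theoretic statement (Noether's second isomorphism theorem in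
character form) for two subgroups `H`, `N` of a commutative group `G` (N = E¹, H = H_𝔪,
G = E¹(𝔸)) and a homomorphism `ψ : H →* M`:

* `toQuot H N : H →* (H ⊔ N) ⧸ N` — the natural map h ↦ [h], surjective (`toQuot_surjective`),
  with kernel `N ⊓ H` (`ker_toQuot`, `mem_ker_toQuot_iff`);
* `descend ψ hψ` — the descended character when ψ kills `N ⊓ H`, with `descend_toQuot`
  (ψ' ∘ [·] = ψ), `exists_descend_iff` (such a ψ' exists ⟺ ψ kills N ⊓ H) and
  `descend_unique`;
* `image_sup_eq_image`, `isOpen_image_of_isOpen` — the subgroup (H ⊔ N)/N of G/N is the image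
  of H, open when H is open (Mathlib `QuotientGroup.isOpenMap_coe`);
* `finiteIndex_ker_of_pow_eq_one` — a character of finite order into `Kˣ` (K a field) has a
  kernel of finite index (its range lies in the finite group of n-th roots of unity).

What stays prose: the compactness of E¹(𝔸)/E¹, Chevalley's theorem on units (the choice of 𝔪),
and the Pontryagin extension from the open subgroup to the whole group (p4's
T5ContinuousCharacterExtension).  README §8(d): this file uses an L-value-free non-vanishing
device: NO.
-/

namespace Summit.Ventures.HodgeRepro2.T5SubgroupDescent

open QuotientGroup

section general

variable {G : Type*} [CommGroup G] (H N : Subgroup G)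

/-- The natural homomorphism `H → (H ⊔ N) ⧸ N`, `h ↦ [h]`. -/
def toQuot : H →* ↥(H ⊔ N) ⧸ N.subgroupOf (H ⊔ N) :=
  (mk' (N.subgroupOf (H ⊔ N))).comp (Subgroup.inclusion le_sup_left)

/-- `toQuot H N h` is the class of `h` viewed in `H ⊔ N`. -/
theorem toQuot_apply (h : H) :
    toQuot H N h = QuotientGroup.mk (Subgroup.inclusion le_sup_left h) := rfl

/-- `toQuot` is surjective: every element of `H ⊔ N` is `h * n`, whose class is that of `h`. -/
theorem toQuot_surjective : Function.Surjective (toQuot H N) := by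
  intro x
  induction x using QuotientGroup.induction_on with
  | H y =>
    obtain ⟨y, hy⟩ := y
    rcases Subgroup.mem_sup.mp hy with ⟨h, hh, n, hn, rfl⟩
    refine ⟨⟨h, hh⟩, ?_⟩
    rw [toQuot_apply]
    refine QuotientGroup.eq.mpr ?_
    simp [Subgroup.mem_subgroupOf, Subgroup.inclusion, hn]

/-- The kernel of `toQuot H N` is `N ⊓ H` (as a subgroup of `H`). -/
theorem ker_toQuot : (toQuot H N).ker = N.subgroupOf H := by
  ext h
  rw [MonoidHom.mem_ker, toQuot_apply, QuotientGroup.eq_one_iff, Subgroup.mem_subgroupOf,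
    Subgroup.mem_subgroupOf, Subgroup.coe_inclusion]

/-- `h ∈ H` goes to `1` in `(H ⊔ N) ⧸ N` iff `h ∈ N`. -/
theorem mem_ker_toQuot_iff (h : H) : h ∈ (toQuot H N).ker ↔ (h : G) ∈ N := by
  rw [ker_toQuot, Subgroup.mem_subgroupOf]

variable {M : Type*} [Group M]

/-- THE DESCENT: a homomorphism `ψ : H →* M` trivial on `N ⊓ H` descends to
`(H ⊔ N) ⧸ N →* M` (through `H ⧸ (N ⊓ H) ≃ (H ⊔ N) ⧸ N`). -/
noncomputable def descend (ψ : H →* M) (hψ : ∀ h : H, (h : G) ∈ N → ψ h = 1) :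
    ↥(H ⊔ N) ⧸ N.subgroupOf (H ⊔ N) →* M :=
  (QuotientGroup.lift (toQuot H N).ker ψ
      (fun h hh => hψ h ((mem_ker_toQuot_iff H N h).mp hh))).comp
    (QuotientGroup.quotientKerEquivOfSurjective (toQuot H N)
      (toQuot_surjective H N)).symm.toMonoidHom

/-- The descended character restricts to `ψ` along `H → (H ⊔ N) ⧸ N`. -/
theorem descend_toQuot (ψ : H →* M) (hψ : ∀ h : H, (h : G) ∈ N → ψ h = 1) (h : H) :
    descend H N ψ hψ (toQuot H N h) = ψ h := by
  unfold descend
  simp only [MonoidHom.comp_apply, MulEquiv.coe_toMonoidHom]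
  have hsymm : (QuotientGroup.quotientKerEquivOfSurjective (toQuot H N)
      (toQuot_surjective H N)).symm (toQuot H N h) = QuotientGroup.mk h := by
    rw [MulEquiv.symm_apply_eq]
    rfl
  rw [hsymm, QuotientGroup.lift_mk]

/-- THE CRITERION of §F.2: `ψ : H →* M` is the restriction of a character of `(H ⊔ N) ⧸ N`
along `h ↦ [h]` IF AND ONLY IF `ψ` is trivial on `N ⊓ H`. -/
theorem exists_descend_iff (ψ : H →* M) :
    (∃ ψ' : ↥(H ⊔ N) ⧸ N.subgroupOf (H ⊔ N) →* M, ∀ h, ψ' (toQuot H N h) = ψ h) ↔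
      ∀ h : H, (h : G) ∈ N → ψ h = 1 := by
  constructor
  · rintro ⟨ψ', hψ'⟩ h hh
    rw [← hψ' h, MonoidHom.mem_ker.mp ((mem_ker_toQuot_iff H N h).mpr hh), map_one]
  · intro hψ
    exact ⟨descend H N ψ hψ, descend_toQuot H N ψ hψ⟩

/-- The descended character is unique (`toQuot` is surjective). -/
theorem descend_unique (ψ' ψ'' : ↥(H ⊔ N) ⧸ N.subgroupOf (H ⊔ N) →* M)
    (h : ∀ x, ψ' (toQuot H N x) = ψ'' (toQuot H N x)) : ψ' = ψ'' := by
  refine MonoidHom.ext fun x => ?_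
  obtain ⟨y, rfl⟩ := toQuot_surjective H N x
  exact h y

/-- In `G ⧸ N` the image of `H ⊔ N` is the image of `H` (the subgroup «E¹H_𝔪/E¹»). -/
theorem image_sup_eq_image :
    (QuotientGroup.mk : G → G ⧸ N) '' ((H ⊔ N : Subgroup G) : Set G) =
      (QuotientGroup.mk : G → G ⧸ N) '' (H : Set G) := by
  ext x
  constructor
  · rintro ⟨y, hy, rfl⟩
    rcases Subgroup.mem_sup.mp hy with ⟨h, hh, n, hn, rfl⟩
    refine ⟨h, hh, ?_⟩
    refine QuotientGroup.eq.mpr ?_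
    simpa using hn
  · rintro ⟨h, hh, rfl⟩
    exact ⟨h, Subgroup.mem_sup_left hh, rfl⟩

end general

section topological

variable {G : Type*} [CommGroup G] [TopologicalSpace G] [ContinuousMul G] (H N : Subgroup G)

/-- If `H` is open in `G` then its image in `G ⧸ N` is open (`QuotientGroup.isOpenMap_coe`):
the «open subgroup E¹H_𝔪/E¹» of §F.2. -/
theorem isOpen_image_of_isOpen (hH : IsOpen (H : Set G)) :
    IsOpen ((QuotientGroup.mk : G → G ⧸ N) '' (H : Set G)) :=
  QuotientGroup.isOpenMap_coe _ hH

/-- The same for `H ⊔ N`. -/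
theorem isOpen_image_sup_of_isOpen (hH : IsOpen (H : Set G)) :
    IsOpen ((QuotientGroup.mk : G → G ⧸ N) '' ((H ⊔ N : Subgroup G) : Set G)) := by
  rw [image_sup_eq_image]
  exact isOpen_image_of_isOpen H N hH

end topological

section finite_order

variable {Γ : Type*} [Group Γ] {K : Type*} [Field K]

/-- A character `ψ : Γ →* Kˣ` of finite order `n` has range inside the `n`-th roots of unity. -/
theorem range_le_rootsOfUnity (ψ : Γ →* Kˣ) (n : ℕ) (hψ : ∀ g, (ψ g) ^ n = 1) :
    ψ.range ≤ rootsOfUnity n K := by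
  rintro _ ⟨g, rfl⟩
  exact (mem_rootsOfUnity n (ψ g)).mpr (hψ g)

/-- «ker(ψ_T|_Γ) has finite index in Γ»: a character of finite order `n ≠ 0` into `Kˣ` has a
kernel of finite index (finitely many `n`-th roots of unity in a field). -/
theorem finiteIndex_ker_of_pow_eq_one (ψ : Γ →* Kˣ) {n : ℕ} (hn : n ≠ 0)
    (hψ : ∀ g, (ψ g) ^ n = 1) : ψ.ker.FiniteIndex := by
  haveI : NeZero n := ⟨hn⟩
  haveI : Finite ψ.range :=
    Finite.of_injective (Subgroup.inclusion (range_le_rootsOfUnity ψ n hψ))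
      (Subgroup.inclusion_injective _)
  exact Subgroup.finiteIndex_ker ψ

end finite_order

end Summit.Ventures.HodgeRepro2.T5SubgroupDescent
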